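import Literature.AlgebraicGeometry.Motives.AbelianVarietyGoodReductionFrobenius
import Literature.AlgebraicGeometry.Motives.AbelianVarietySimpleFactorsUnique
import HarnessLib

/-!
# From the Eichler–Shimura relation for the honest Hecke correspondences to the PINNED, `m`-cleared identity
# `m₁m₂·π² − m₂·θ̄₁π + m₁q·θ̄₂ = 0` (transport lemma «L3b» of the D9op road 2′)

Topic `Literature/AlgebraicGeometry/Motives`, namespace `Literature.AlgebraicGeometry.Motives.AbelianVariety`.  THEOREMS ONLY (no definition,
no named fact, no instance, no sorry).  Cell `hodgecm-mathlib` (D-0151), FLOOR-0 P5, sub-line `Cruxes/HLiu418/Lines/F0_D9opRoad2` (registry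
24832, stub `stub_L3 : RecordCurveEichlerShimuraModel`), interface letter `A-provers/A-p11/g15/F0P5a/L3b-INTERFACE-letter.v0.A-p11g15.md`.

THE POINT ([Liu2021] proof of Cor. D.9, p. 139; [Shimura1971] §7.4 (7.4.1)–(7.4.3); [DiamondShurman2005] Thm. 8.7.2 «`T̃_p = F + ⟨p⟩ V`»).
The registered letter pins the Hecke operators `T_{w,i} = [K twᵢ K]` of the tower only `ℓ`-ADICALLY: endomorphisms `θᵢ` of `A_K = Alb(M⋆_K)`
with integers `mᵢ ≠ 0` (`[ᵗV_ℓ θᵢ φ]_K = mᵢ • T_{w,i}[φ]_K`); ★ A-L3-5 (`atr_comp_eq_smul_sum_albTr_of_pin`, A-p05) turns a pin into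
`Alb(u) ≫ θᵢ = mᵢ • Σ_α Alb(T_{r α})` in `Hom(A_N, A_K)` for an auxiliary level `N ⊆ K`.  BUT `A_N` HAS BAD REDUCTION at `w` (the level `N`
is Iwahori at `w`), so no identity in `Hom(Ā_N, Ā_K)` can be the interface.  Composing with the Albanese TRACE `t_u : A_K → A_N`
(`t_u ≫ Alb(u) = d • 𝟙`, `d = [K : N]`, ★ `Albanese.trace_comp_map_eq_card_smul`) moves everything to `End(A_K)`, which HAS good reduction:
`d • θᵢ = mᵢ • 𝒯ᵢ` with `𝒯ᵢ := t_u ≫ Σ_α Alb(T_{r α}) ∈ End(A_K)` the trace-scaled HONEST Hecke correspondence (§1, pure category algebra).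
The geometric input (L3a) is then the classical congruence relation for the honest correspondences on the good special fibre `Ā_K`:
`redEnd 𝒯₁ = d • π + redEnd 𝒯₂ * V` with `V * π = q` («`T_p = F + ⟨p⟩V`», `V` the Verschiebung, `⟨ϖ⟩ = T_{w,2}`), and §2 derives the
registered pinned identity by ring algebra and the torsion-freeness of `End Ā_K` ([Milne1986AbelianVarieties] Lemma 12.2).

* §1 `zsmul_eq_zsmul_trace_comp_of_pin` — `Alb(u) ≫ θ = m • S`, `t ≫ Alb(u) = d • 𝟙` ⟹ `d • θ = m • (t ≫ S)`.
* §2 **`GoodReductionAt.pinned_eichlerShimura_of_honest_mul`** (V-free «(ES·π)» door, the registered one: `redEnd 𝒯₁ * π = d • π² + q • redEnd 𝒯₂`)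
  and **`GoodReductionAt.pinned_eichlerShimura_of_honest`** (Verschiebung door: (ES) `redEnd 𝒯₁ = d • π + redEnd 𝒯₂ * V`, (Ver) `V * π = q`):
  with pins `d • θᵢ = mᵢ • 𝒯ᵢ`, `d ≠ 0` ⟹ `(m₁m₂) • π² − m₂ • (redEnd θ₁ * π) + (m₁ q) • redEnd θ₂ = 0` in `End Ā` — token-compatible with the
  conclusion of `RecordCurveEichlerShimuraModel` (`π = End.of (frobeniusHom R.reduction)`, `q = Ideal.absNorm w`).

HC_CM is proved only modulo the 7 printed citations until rung 0 closes; this file is generic algebra over ★ `GoodReductionAt`.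

## References
* [Liu2021] Y. Liu, *Fourier–Jacobi cycles and arithmetic relative trace formula*, Camb. J. Math. 9 (2021), App. D, proof of Cor. D.9 (p. 139).
* [DiamondShurman2005] F. Diamond, J. Shurman, *A First Course in Modular Forms*, GTM 228, Thm. 8.7.2 (p. 353) (Eichler–Shimura relation
  `T̃_p = F + ⟨p⟩V` on `Pic⁰`).
* [Shimura1971] G. Shimura, *Introduction to the Arithmetic Theory of Automorphic Functions*, §7.4, (7.4.1)–(7.4.3).
* [Milne1986AbelianVarieties] J. S. Milne, *Abelian Varieties* (Cornell–Silverman 1986), §12 Lemma 12.2 (`Hom` is torsion-free).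
* [Lang1983AbelianVarieties] S. Lang, *Abelian Varieties*, Ch. VIII §6 Thm. 13 (`f_* h_* = m·δ`).
-/

set_option autoImplicit false

noncomputable section

open CategoryTheory

universe u

namespace Literature.AlgebraicGeometry.Motives.AbelianVariety

/-! ## §1 Pin scaling through the Albanese trace -/

section Pin

variable {K : Type u} [Field K] {A_N A_K : AbelianVariety K}

/-- **A pin up to an isogeny becomes an identity in `End(A_K)` through the trace**: if `Alb(u) ≫ θ = m • S` in `Hom(A_N, A_K)` (★ A-L3-5,
the Hecke pin read geometrically) and `t ≫ Alb(u) = d • 𝟙_{A_K}` (the Albanese trace of the degree-`d` covering, [Lang1983AbelianVarieties]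
VIII §6 Thm. 13, ★ `Albanese.trace_comp_map_eq_card_smul`), then `d • θ = m • (t ≫ S)` — both sides live in `End(A_K)`, which has good
reduction where `A_K` does. [cite: Lang1983AbelianVarieties, Ch. VIII §6 Thm. 13 (pp. 224–227)] [cite: Liu2021, App. D proof of Cor. D.9 (p. 139)] -/
theorem zsmul_eq_zsmul_trace_comp_of_pin (Atr : A_N ⟶ A_K) (t : A_K ⟶ A_N) (d : ℤ) (htr : t ≫ Atr = d • 𝟙 A_K)
    {θ : A_K ⟶ A_K} {m : ℤ} {S : A_N ⟶ A_K} (hpin : Atr ≫ θ = m • S) :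
    d • θ = m • (t ≫ S) := by
  calc d • θ = (d • 𝟙 A_K) ≫ θ := by rw [Preadditive.zsmul_comp, Category.id_comp]
    _ = (t ≫ Atr) ≫ θ := by rw [htr]
    _ = t ≫ (Atr ≫ θ) := Category.assoc _ _ _
    _ = m • (t ≫ S) := by rw [hpin, Preadditive.comp_zsmul]

end Pin

/-! ## §2 The pinned, `m`-cleared congruence relation from the honest one -/

namespace GoodReductionAt

variable {K : Type} [Field K] [NumberField K] {A₀ : AbelianVariety K}
  {v : IsDedekindDomain.HeightOneSpectrum (NumberField.RingOfIntegers K)} (R : A₀.GoodReductionAt v)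

/-- **L3b, V-free «(ES·π)» form (the registered door; F0P5a LEAD WORD #1 (2)): the pinned identity from the honest congruence relation
right-multiplied by `π`.**  Let `R` be a good-reduction datum of `A₀` at `v`, `π = frobeniusHom` of the reduction, `q : ℕ`, and let `𝒯₁, 𝒯₂ ∈ End A₀`
satisfy `redEnd 𝒯₁ * π = d • (π * π) + q • redEnd 𝒯₂` («`T̃_p · F = F² + q⟨p⟩`», i.e. `T̃_p = F + ⟨p⟩V` times `F`, `d`-scaled: `𝒯ᵢ = d · T_{w,i}`); let
`(θᵢ, mᵢ)` be pins with `d • θᵢ = mᵢ • 𝒯ᵢ`, `d ≠ 0`.  Then `(m₁m₂) • π² − m₂ • (redEnd θ₁ * π) + (m₁ q) • redEnd θ₂ = 0` in `End Ā` — the conclusion of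
the D9op sub-line's letter `RecordCurveEichlerShimuraModel`, token for token (`π = End.of (frobeniusHom R.reduction)`, `q = Ideal.absNorm w`).  Proof:
`redEnd` is a ring map, so `d • θ̄ᵢ = mᵢ • 𝒯̄ᵢ`; `d •`(LHS) `= m₁m₂d•π² − m₁m₂•(𝒯̄₁ π) + m₁m₂q•𝒯̄₂ = 0` by the hypothesis; `End Ā` is torsion-free
([Milne1986AbelianVarieties] Lemma 12.2, ★ `isIsogeny_zsmul_id_holds`).  No Verschiebung, no centrality or invertibility of `π` is used.
[cite: DiamondShurman2005, Thm. 8.7.2 (p. 353)] [cite: Shimura1971, §7.4 (7.4.1)–(7.4.3)] [cite: Liu2021, App. D proof of Cor. D.9 (p. 139)]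
[cite: Milne1986AbelianVarieties, §12 Lemma 12.2 (PDF p. 189)] -/
theorem pinned_eichlerShimura_of_honest_mul (q : ℕ) {d : ℤ} (hd : d ≠ 0) {𝒯₁ 𝒯₂ : End A₀}
    (hESπ : R.redEnd 𝒯₁ * End.of (frobeniusHom R.reduction) =
      d • (End.of (frobeniusHom R.reduction) * End.of (frobeniusHom R.reduction)) + (q : ℤ) • R.redEnd 𝒯₂)
    {θ₁ θ₂ : End A₀} {m₁ m₂ : ℤ} (h₁ : d • θ₁ = m₁ • 𝒯₁) (h₂ : d • θ₂ = m₂ • 𝒯₂) :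
    (m₁ * m₂) • (End.of (frobeniusHom R.reduction) * End.of (frobeniusHom R.reduction))
      - m₂ • (R.redEnd θ₁ * End.of (frobeniusHom R.reduction))
      + (m₁ * (q : ℤ)) • R.redEnd θ₂ = 0 := by
  set π : End R.reduction := End.of (frobeniusHom R.reduction) with hπ
  set T₂ : End R.reduction := R.redEnd 𝒯₂ with hT₂
  -- the pins after reduction (`redEnd` is additive)
  have h₁' : d • R.redEnd θ₁ = m₁ • R.redEnd 𝒯₁ := by rw [← map_zsmul, h₁, map_zsmul]
  have h₂' : d • R.redEnd θ₂ = m₂ • T₂ := by rw [← map_zsmul, h₂, map_zsmul]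
  -- `d •` the target vanishes
  have eA : d • (m₂ • (R.redEnd θ₁ * π)) = (m₂ * m₁ * d) • (π * π) + (m₂ * m₁ * (q : ℤ)) • T₂ := by
    rw [smul_comm, ← smul_mul_assoc, h₁', smul_mul_assoc, hESπ, smul_add, smul_smul, smul_smul, smul_add, smul_smul,
      smul_smul, mul_assoc, mul_assoc]
  have eB : d • ((m₁ * (q : ℤ)) • R.redEnd θ₂) = (m₁ * (q : ℤ) * m₂) • T₂ := by
    rw [smul_comm, h₂', smul_smul]
  have key : d • ((m₁ * m₂) • (π * π) - m₂ • (R.redEnd θ₁ * π) + (m₁ * (q : ℤ)) • R.redEnd θ₂) = 0 := by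
    rw [smul_add, smul_sub, smul_smul, eA, eB]
    module
  exact eq_zero_of_zsmul_eq_zero_of_isIsogeny (isIsogeny_zsmul_id_holds _ d hd) key

/-- **L3b, Verschiebung form: the pinned identity from the honest Eichler–Shimura relation `T̃_p = F + ⟨p⟩V`.**  With `V ∈ End Ā`,
`V * π = q` (Verschiebung) and `redEnd 𝒯₁ = d • π + redEnd 𝒯₂ * V` (HONEST congruence relation, `d`-scaled), the «(ES·π)» hypothesis of
`pinned_eichlerShimura_of_honest_mul` follows by right-multiplying with `π` (associativity only), hence the pinned identity.  Both doors stay open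
for the pole: the V-free form is the registered letter's, this one is print's «`T̃_p = F + ⟨p⟩V`».
[cite: DiamondShurman2005, Thm. 8.7.2 (p. 353)] [cite: Shimura1971, §7.4 (7.4.1)–(7.4.3)] [cite: Liu2021, App. D proof of Cor. D.9 (p. 139)] -/
theorem pinned_eichlerShimura_of_honest (q : ℕ) {V : End R.reduction}
    (hV : V * End.of (frobeniusHom R.reduction) = (q : End R.reduction))
    {d : ℤ} (hd : d ≠ 0) {𝒯₁ 𝒯₂ : End A₀}
    (hES : R.redEnd 𝒯₁ = d • End.of (frobeniusHom R.reduction) + R.redEnd 𝒯₂ * V)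
    {θ₁ θ₂ : End A₀} {m₁ m₂ : ℤ} (h₁ : d • θ₁ = m₁ • 𝒯₁) (h₂ : d • θ₂ = m₂ • 𝒯₂) :
    (m₁ * m₂) • (End.of (frobeniusHom R.reduction) * End.of (frobeniusHom R.reduction))
      - m₂ • (R.redEnd θ₁ * End.of (frobeniusHom R.reduction))
      + (m₁ * (q : ℤ)) • R.redEnd θ₂ = 0 := by
  refine R.pinned_eichlerShimura_of_honest_mul q hd ?_ h₁ h₂
  rw [hES, add_mul, smul_mul_assoc, mul_assoc, hV, ← nsmul_eq_mul', natCast_zsmul]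

end GoodReductionAt

end Literature.AlgebraicGeometry.Motives.AbelianVariety

end
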